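import Mathlib
import Mathlib.Analysis.InnerProductSpace.GramSchmidtOrtho
import Mathlib.Analysis.Asymptotics.Defs
import Mathlib.Analysis.SpecialFunctions.Log.Basic
import Mathlib.Data.Nat.Sqrt
import Literature.Algebra.EuclideanLattices.Problems
import Literature.Algebra.EuclideanLattices.Encoding
import Literature.Computability.Cryptography.LWE
import Literature.Computability.Cryptography.LWENoise
import Literature.Computability.Cryptography.PQCLWE
import Literature.Algebra.EuclideanLattices.LatticeComplexity
import Literature.Computability.Complexity.BoolEncodings
import Literature.Computability.Complexity.Oracle
import Literature.Computability.Cryptography.OracleGames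
import Literature.Computability.Cryptography.QuantumCircuit
import Literature.Computability.Cryptography.ClassBQP
import HarnessLib.Audit
import Literature.Computability.Cryptography.LWEHardness
import HarnessLib

/-!
# LWENotInBQP — CONJECTURE (obligation of PneNP/PneNP)

Unproven conjecture migrated by the gate from `Literature/Computability/Cryptography/LWEHardness.lean` (`Literature.Computability.Cryptography.LWENotInBQP`): unproven conjectures are obligations of our
theories, not literature facts (human ruling 2026-08-15). Provenance: Regev2009. Routes use it as a crux item or via
`--conditional-bridge --conditional-on LWENotInBQP`; a proof goes in the sibling `Theorems/LWENotInBQPHolds.lean` as `theorem LWENotInBQP_holds : LWENotInBQP` so this file stays a conjecture LEAF that Literature/ may import.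
-/

namespace Summit.PneNP.PneNP

open Literature Literature.Computability Literature.Computability.Cryptography
open Filter Asymptotics Computability Literature.Computability.Complexity Literature.Computability.Cryptography.LWE Literature.Algebra.EuclideanLattices Literature.Computability.Cryptography
open scoped ENNReal
open Literature.Computability.Complexity (Oracle)
open Literature.Computability.Complexity.Oracle
open Literature.Algebra.EuclideanLattices

/-- OPEN CONJECTURE — **pqc.S01** (peak; `LWE ∉ BQP`, the quantum hardness of LWE; negation
form of summits/fw-lwe-bqp/SUMMIT.md). POSED, not proved, in Regev 2009, §1 (J. ACM 56(6),
art. 34; arXiv:2401.03703, p. 4): "One might even conjecture that there is no quantum polynomial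
time algorithm that approximates GapSVP (or SIVP) to within any polynomial factor. One can then
interpret the main theorem as saying that based on this conjecture, the LWE problem is hard. The
only evidence supporting this conjecture is that there are no known quantum algorithms for
lattice problems that outperform classical algorithms, even though this is probably one of the
most important open questions in the field of quantum computing." The only theorem there is the
quantum reduction Thm 1.1 (`GapSVP`/`SIVP` within `Õ(n/α)` ≤ `LWE_{q,Ψ̄_α}`, vendored as
`regev_lwe_to_sivp_quantum` / `regev_lwe_to_gapSVP_quantum`, pqc.S19), and the best known
algorithm for LWE takes `2^{O(n)}` equations/time (ibid., p. 3). Registered OPEN statement, not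
literature debt: no `LWENotInBQP_holds` is expected (defact verdict 2026-08-15, open-problem);
the name is kept because `lweNotInBQP_iff`, `lweInBQP_iff_not_lweNotInBQP`, the module docstring
of `LWEHardnessProofs` and the PneNP `Lattice` thesis refer to it.
STATEMENT. For every modulus `q`, noise rate `α` and `c₀` in Regev's regime (`q` polynomially
bounded, `q n ≥ 2`, eventually `0 < α n`, `α n · q n ≥ 2√n` — the summit's WEAK inequality,
contrast with the strict `>` of Regev's Thm 1.1 in `pqc.S19` — and `1/α n ≤ n^{c₀}`), every
polynomially bounded number of samples `m`, and every polynomial-time uniform quantum circuit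
family `Q` (G11), `Q` does NOT solve search-`LWE_{q(n), Ψ̄_{α(n)}}` from `m n` samples with
average-case success probability `≥ 2/3` for all large `n`; i.e. (`lweNotInBQP_iff`) its success
probability is `< 2/3` for infinitely many `n`.
[cite: Regev2009, §1 (arXiv:2401.03703 p. 4; conjecture posed)] [status: open] -/
@[conjecture] def LWENotInBQP : Prop :=
  ∀ (q : ℕ → ℕ) (α : ℕ → ℝ) (c₀ : ℕ) (m : ℕ → ℕ) (h : RegevRegime q α c₀), IsPolyBounded m →
    haveI := h.neZero
    ∀ Q : UniformQCircuitFamily, ¬ SearchLWESolves q (fun n => discretizedGaussian (q n) (α n)) m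
      (fun n => Q.searchLWESolver n (q n) (m n)) fun _ => 2 / 3

end Summit.PneNP.PneNP
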